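import Summits.QuantumFields.YangMills.Theorems.OnsetSkewLawRPOnsetFloorOSPigeonhole
import Summits.QuantumFields.YangMills.Theorems.BalabanLadderInfVolFloorsCore
import Summits.QuantumFields.YangMills.Theorems.UniversalDetectorReflectedKernel
import Summits.QuantumFields.YangMills.Theorems.SubOnsetCeilings.Negative.CubeKernelLaplace
import Summits.QuantumFields.YangMills.Theorems.BalabanLadderInfVolRPSquare
import HarnessLib

/-!
# OS-seminorm pigeonhole (helper package for `stub_coarseCollarAtomRPFloor` of LINES 2/3, ym-idea-11 g13)

The pigeonhole step of the shared coarse-collar-atom stub (`StubCoarseCollarP`, skeletons «FloorInheritance» on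
`OnsetSkewLaw.RPOnsetFloor` 23138 and «MarkovFloorInheritance» on `MarkovAtoms.OnsetFloor` 22956), isolated and PROVED:

* `os_pigeonhole` (pure): if a pair series `Σ' a'ⱼ aᵢ Mⱼᵢ` of two `ℓ¹` coefficient families (masses `≤ K', K`) against a kernel
  dominated by a product of non-negative bounded "seminorms", `|Mⱼᵢ| ≤ n'ⱼ nᵢ`, is at least `ε > 0`, then some ACTIVE index on one
  of the two sides has seminorm square `≥ ε/(K K')`;
* `crossFloor_of_torusFloor` (STEP S1 of the memo, PROVED): a torus two-point floor `ε ≤ Q2 G r β L s w v` for all large tori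
  passes to every odd-torus limit state `μ` as the RANDOM-VARIABLE-LEVEL cross floor
  `ε ≤ Cov_μ(Σ'_x w(s x)·dens_x, Σ'_y v(s y)·dens_y)` (tree `InfiniteVolume.tendsto_Q2` + `covariance_tsum_tsum`);
  `crossFloor_of_onsetFloorQ2` packages it in the shape of the skeletons' residual `OnsetFloorQ2`;
* `abs_cov_le_osNorm_mul`: the tree's abstract RP Cauchy–Schwarz (`RPCauchySchwarz.covariance_rp_cauchySchwarz`) in seminorm form
  `|Cov(F∘Θ, G)| ≤ ‖F‖_OS ‖G‖_OS`, `‖F‖_OS = √Cov(F∘Θ, F)`, for observables in an RP cone.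

Planner ym-idea-11 g13.  HONEST LABEL: helper lemmas; no stub / crux / rung / summit is proved; YM mass gap NOT proved.

LANDING NOTE: this is part 2 (§§ CrossFloor / SmearCone: S1 `crossFloor_of_torusFloor`, S2a `smear` / `smearR` /
`smear_thetaTest_eq_smearR_cfgReflect` / `coneCrossFloor_of_torusFloor`) of planner ym-idea-11 g13's HOME file
`pub/ideators/ym-idea-11/g13/OSPigeonhole.lean` v3 (sha ca88f963), split VERBATIM for the 400-line rule; part 1 (§§ Pigeonhole /
RPCS / Expansion) is `OnsetSkewLawRPOnsetFloorOSPigeonhole.lean`.  Landed by width seat ym-line-sfw-p2-w5 g16 on the planner's GO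
(cell STATUS 2026-08-29T04:23:44Z); authorship: planner ym-idea-11 g13.  Deviations from the HOME text: three one-line docstrings
(lint), one widened `omit`, and `abs_plane_le_N` taken from the route-independent `SubOnsetCeilings.Negative.CubeKernelLaplace` instead of
`OnsetSkewLawOnsetVanishing` (gate lint `theses-cone`).
-/

set_option autoImplicit false

noncomputable section

open MeasureTheory ProbabilityTheory
open scoped BigOperators
open Summit.QuantumFields.YangMills.Theorems.FiniteSusceptibilityWeakCoupling.RPCauchySchwarz (covariance_rp_cauchySchwarz)

namespace Summit.QuantumFields.YangMills.Theorems.OnsetSkewLawRPOnsetFloorOSPigeonhole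

section CrossFloor

open Filter Topology
open Literature.MathematicalPhysics.QuantumFieldTheory Literature.MathematicalPhysics.QuantumLattice
open Literature.Probability.LatticeModels (Site)
open Summit.QuantumFields.YangMills.Cruxes.OSLegsFromFemtoAndGap.DlrCollarTransfer
open Summit.QuantumFields.YangMills.Theorems.InfiniteVolume

variable (G : Type) [Group G] [TopologicalSpace G] [IsTopologicalGroup G] [CompactSpace G]
  [MeasurableSpace G] [BorelSpace G] (r : LatticeRep G)

/-- Odd-torus limit states are probability measures. [folklore] -/
theorem isProbabilityMeasure_of_mem_oddTorusLimitPoints {β : ℝ} {μ : Measure (LGConfig 4 G)}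
    (hμ : μ ∈ oddTorusLimitPoints r β) : IsProbabilityMeasure μ := by
  have hμinf : μ ∈ infiniteVolumeLimitPoints (d := 4) r.ρ β := by
    obtain ⟨S, hS, h⟩ := hμ
    exact ⟨fun k => 2 * S k, fun i j hij => Nat.mul_lt_mul_of_pos_left (hS hij) two_pos, h⟩
  obtain ⟨L, -, hprob, -⟩ := hμinf
  exact hprob

/-- **The smeared two-point series is the covariance of the smeared observables** (random-variable level):
`Σ'_{(x,y)} w(s x) v(s y) Cov_μ(dens_x, dens_y) = Cov_μ(Σ'_x w(s x) dens_x, Σ'_y v(s y) dens_y)` for Schwartz `w, v`, `s > 0`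
and a probability measure `μ`. [folklore] -/
theorem q2Series_eq_covariance (μ : Measure (LGConfig 4 G)) [IsProbabilityMeasure μ]
    (w v : SchwartzMap (EuclideanSpace ℝ (Fin 4)) ℝ) {s : ℝ} (hs : 0 < s) :
    (∑' p : Site 4 × Site 4, w (s • siteToE p.1) * v (s • siteToE p.2) *
        ((∫ U, dens G r p.1 U * dens G r p.2 U ∂μ) - (∫ U, dens G r p.1 U ∂μ) * ∫ U, dens G r p.2 U ∂μ)) =
      cov[fun U => ∑' x : Site 4, w (s • siteToE x) * dens G r x U,
          fun U => ∑' y : Site 4, v (s • siteToE y) * dens G r y U; μ] := by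
  haveI : SecondCountableTopology G :=
    (r.continuous.isClosedEmbedding r.injective).isEmbedding.secondCountableTopology
  obtain ⟨C, hC0, hC⟩ := exists_abs_dens_le_uniform (G := G) r
  have hmeas : ∀ x : Site 4, Measurable (dens G r x) := fun x => (continuous_dens r x).measurable
  rw [covariance_tsum_tsum (μ := μ) (ι := Site 4) (κ := Site 4) (a := fun y => v (s • siteToE y))
    (a' := fun x => w (s • siteToE x)) (summable_abs_schwartz_lattice v hs) (summable_abs_schwartz_lattice w hs)
    (F := dens G r) (G := dens G r) hmeas hmeas (B := C) hC hC]
  refine tsum_congr fun p => ?_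
  have h2 : ∀ x : Site 4, MemLp (dens G r x) 2 μ := fun x =>
    MemLp.of_bound (hmeas x).aestronglyMeasurable C (ae_of_all _ fun U => by rw [Real.norm_eq_abs]; exact hC x U)
  rw [covariance_eq_sub (h2 p.1) (h2 p.2)]
  rfl

variable {G r}

/-- **S1 — a torus two-point floor passes to every odd-torus limit state as a random-variable-level cross floor.**
If `ε ≤ Q2 G r β L s w v` on all odd tori `2L+1` with `Λ₅ ≤ s·L`, then for every `μ ∈ oddTorusLimitPoints r β`:
`ε ≤ Cov_μ(Σ'_x w(s x)·dens_x, Σ'_y v(s y)·dens_y)`.  (Tree `InfiniteVolume.tendsto_Q2` — Tannery along the defining tori —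
then `q2Series_eq_covariance`.) [folklore] -/
theorem crossFloor_of_torusFloor {β s ε Λ₅ : ℝ} (hs : 0 < s) (w v : SchwartzMap (EuclideanSpace ℝ (Fin 4)) ℝ)
    (hfloor : ∀ L : ℕ, Λ₅ ≤ s * L → ε ≤ Q2 G r β L s w v)
    {μ : Measure (LGConfig 4 G)} (hμ : μ ∈ oddTorusLimitPoints r β) :
    ε ≤ cov[fun U => ∑' x : Site 4, w (s • siteToE x) * dens G r x U,
          fun U => ∑' y : Site 4, v (s • siteToE y) * dens G r y U; μ] := by
  haveI : IsProbabilityMeasure μ := isProbabilityMeasure_of_mem_oddTorusLimitPoints G r hμ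
  obtain ⟨S, hS, hlim⟩ := hμ
  rw [← q2Series_eq_covariance G r μ w v hs]
  refine ge_of_tendsto (tendsto_Q2 r hS hlim hs w v) ?_
  have ht : Tendsto (fun k => s * ((S k : ℕ) : ℝ)) atTop atTop :=
    (tendsto_natCast_atTop_atTop.comp hS.tendsto_atTop).const_mul_atTop hs
  filter_upwards [ht.eventually_ge_atTop Λ₅] with k hk
  exact hfloor (S k) hk

/-- **S1 in the shape of the skeletons' residual `OnsetFloorQ2`** (its body, verbatim, as the hypothesis): the two-point onset
floor datum gives, for every `SU(2)`-class `G`, a datum `r`, a positive-time Schwartz `v` and `ε > 0` such that for `β ≥ β₅` there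
is a spacing `s ∈ (0,1]` with the RV-level cross floor `ε ≤ Cov_μ(A_{θv,s}, A_{v,s})` in EVERY odd-torus limit state `μ`. [folklore] -/
theorem crossFloor_of_onsetFloorQ2
    (h : ∀ (G : Type) [Group G] [TopologicalSpace G] [IsTopologicalGroup G] [CompactSpace G],
      IsCompactSimpleLieGroup G → Nonempty (G ≃ₜ* Matrix.specialUnitaryGroup (Fin 2) ℂ) →
      letI : MeasurableSpace G := borel G
      haveI : BorelSpace G := ⟨rfl⟩
      ∃ (r : LatticeRep G) (v : SchwartzMap (EuclideanSpace ℝ (Fin 4)) ℝ) (ε Λ₅ β₅ : ℝ),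
        tsupport v ⊆ {y : EuclideanSpace ℝ (Fin 4) | 0 < y 0} ∧ 0 < ε ∧
        ∀ β : ℝ, β₅ ≤ β → ∃ s : ℝ, 0 < s ∧ s ≤ 1 ∧ ∀ L : ℕ, Λ₅ ≤ s * L → ε ≤ Q2 G r β L s (thetaTest 4 v) v)
    (G : Type) [Group G] [TopologicalSpace G] [IsTopologicalGroup G] [CompactSpace G]
    (hG : IsCompactSimpleLieGroup G) (hSU : Nonempty (G ≃ₜ* Matrix.specialUnitaryGroup (Fin 2) ℂ)) :
    letI : MeasurableSpace G := borel G
    haveI : BorelSpace G := ⟨rfl⟩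
    ∃ (r : LatticeRep G) (v : SchwartzMap (EuclideanSpace ℝ (Fin 4)) ℝ) (ε β₅ : ℝ),
      tsupport v ⊆ {y : EuclideanSpace ℝ (Fin 4) | 0 < y 0} ∧ 0 < ε ∧
      ∀ β : ℝ, β₅ ≤ β → ∃ s : ℝ, 0 < s ∧ s ≤ 1 ∧ ∀ μ ∈ oddTorusLimitPoints r β,
        ε ≤ cov[fun U => ∑' x : Site 4, thetaTest 4 v (s • siteToE x) * dens G r x U,
              fun U => ∑' y : Site 4, v (s • siteToE y) * dens G r y U; μ] := by
  letI : MeasurableSpace G := borel G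
  haveI : BorelSpace G := ⟨rfl⟩
  obtain ⟨r, v, ε, Λ₅, β₅, hv, hε, hβ⟩ := h G hG hSU
  refine ⟨r, v, ε, β₅, hv, hε, fun β hb => ?_⟩
  obtain ⟨s, hs, hs1, hfl⟩ := hβ β hb
  exact ⟨s, hs, hs1, fun μ hμ => crossFloor_of_torusFloor hs (thetaTest 4 v) v hfl hμ⟩

end CrossFloor

section SmearCone

/-! ### S2a — the smeared fields `A_{v,s}`, the reflected companion `B′_{v,s}`, and their positive-time support

With BASE-SITE sampling (the tree's `Q2`), the Θ-side observable of the cross form is NOT `A_{v,s} ∘ Θ` but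
`A_{θv,s} = B′_{v,s} ∘ Θ_cfg` with `B′_{v,s}(V) = Σ_q Σ'_x v(s·(x + ℓ_q)) · plane_q x V`, `ℓ_q = [q.1 = 0]·e₀`
(temporal plaquettes read one layer higher: tree `dens_cfgReflect_eq_sum_plane`, `reflSite`). Both `A_{v,s}` and `B′_{v,s}`
live in the positive-time cone when `tsupport v ⊆ {y₀ > 0}`. -/

open Literature.MathematicalPhysics.QuantumFieldTheory Literature.MathematicalPhysics.QuantumLattice
open Literature.Probability.LatticeModels (Site)
open Summit.QuantumFields.YangMills.Cruxes.OSLegsFromFemtoAndGap.DlrCollarTransfer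
open Summit.QuantumFields.YangMills.Theorems.InfiniteVolume Summit.QuantumFields.YangMills.Theorems.InfVolRP
open Summit.QuantumFields.YangMills.Cruxes.UniversalDetectorPlaneTight (dens_cfgReflect_eq_sum_plane dens_eq_sum_plane_univ)
open Summit.QuantumFields.YangMills.Theorems.SubOnsetCeilings.Negative (abs_plane_le_N)
open Summit.QuantumFields.GaugeBoot (siteHalfEdges)

variable (G : Type) [Group G] [TopologicalSpace G] [IsTopologicalGroup G] [CompactSpace G]
  [MeasurableSpace G] [BorelSpace G] (r : LatticeRep G)

/-- The time-layer shift of orientation `q`: `e₀` for temporal (`q.1 = 0`), `0` for spatial orientations. -/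
def layerShift (q : Fin 4 × Fin 4) : Site 4 := if q.1 = 0 then Pi.single 0 1 else 0

/-- The time component of the layer shift is at most `1`. [folklore] -/
theorem layerShift_apply_zero_le_one (q : Fin 4 × Fin 4) : layerShift q 0 ≤ 1 := by
  unfold layerShift; split_ifs <;> simp

/-- The reflected plaquette base in terms of `siteReflect` and the layer shift. [folklore] -/
theorem reflSite'_eq (q : Fin 4 × Fin 4) (x : Site 4) :
    (if q.1 = 0 then siteReflect x - Pi.single 0 1 else siteReflect x) = siteReflect x - layerShift q := by
  unfold layerShift; split_ifs <;> simp

/-- The reindexing bijection `x ↦ θ₀x − ℓ` of `ℤ⁴` (inverse `x' ↦ θ₀(x' + ℓ)`). -/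
def reflShift (ℓ : Site 4) : Site 4 ≃ Site 4 where
  toFun x := siteReflect x - ℓ
  invFun x' := siteReflect (x' + ℓ)
  left_inv x := by simp [siteReflect_siteReflect]
  right_inv x' := by simp [siteReflect_siteReflect]

/-- `reflShift ℓ x = siteReflect x − ℓ`. [folklore] -/
theorem reflShift_apply (ℓ x : Site 4) : reflShift ℓ x = siteReflect x - ℓ := rfl

/-- **`A_{v,s}`** — the `v`-smeared action density at spacing `s`: `A_{v,s}(U) = Σ'_x v(s x) · dens_x U`. -/
def smear (v : EuclideanSpace ℝ (Fin 4) → ℝ) (s : ℝ) (U : LGConfig 4 G) : ℝ :=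
  ∑' x : Site 4, v (s • siteToE x) * dens G r x U

/-- **`B′_{v,s}`** — the reflected companion: `B′_{v,s}(V) = Σ_q Σ'_x v(s·(x + ℓ_q)) · plane_q x V`. -/
def smearR (v : EuclideanSpace ℝ (Fin 4) → ℝ) (s : ℝ) (V : LGConfig 4 G) : ℝ :=
  ∑ q : {q : Fin 4 × Fin 4 // q.1 < q.2}, ∑' x : Site 4, v (s • siteToE (x + layerShift q.1)) * plane G r q.1 x V

omit [IsTopologicalGroup G] [CompactSpace G] [BorelSpace G] in
/-- An `ℓ¹` weight against the bounded single planes is summable. -/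
theorem summable_weight_mul_plane {w : Site 4 → ℝ} (hw : Summable fun x => |w x|) (q : Fin 4 × Fin 4)
    (y : Site 4 → Site 4) (V : LGConfig 4 G) : Summable fun x => w x * plane G r q (y x) V :=
  Summable.of_norm_bounded (hw.mul_right (r.N : ℝ)) fun x => by
    rw [Real.norm_eq_abs, abs_mul]
    exact mul_le_mul_of_nonneg_left (abs_plane_le_N r q (y x) V) (abs_nonneg _)

/-- Translated Schwartz lattice samples are `ℓ¹`. -/
theorem summable_abs_schwartz_lattice_shift (v : SchwartzMap (EuclideanSpace ℝ (Fin 4)) ℝ) {s : ℝ} (hs : 0 < s)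
    (ℓ : Site 4) : Summable fun x : Site 4 => |v (s • siteToE (x + ℓ))| :=
  (Equiv.addRight ℓ).summable_iff.2 (summable_abs_schwartz_lattice v hs)

/-- **Plane expansion of the smeared field**: `A_{v,s}(U) = Σ_q Σ'_x v(s x) · plane_q x U`. -/
theorem smear_eq_sum_tsum_plane {v : EuclideanSpace ℝ (Fin 4) → ℝ} {s : ℝ}
    (hv : Summable fun x : Site 4 => |v (s • siteToE x)|) (U : LGConfig 4 G) :
    smear G r v s U = ∑ q : {q : Fin 4 × Fin 4 // q.1 < q.2}, ∑' x : Site 4, v (s • siteToE x) * plane G r q.1 x U := by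
  unfold smear
  simp_rw [dens_eq_sum_plane_univ r, Finset.mul_sum]
  exact Summable.tsum_finsetSum fun q _ => summable_weight_mul_plane G r hv q.1 id U

/-- **The Θ-side observable is the reflected companion composed with the field reflection**:
`A_{θv,s}(U) = B′_{v,s}(Θ_cfg U)`. [folklore] -/
theorem smear_thetaTest_eq_smearR_cfgReflect (v : SchwartzMap (EuclideanSpace ℝ (Fin 4)) ℝ) {s : ℝ} (hs : 0 < s)
    (U : LGConfig 4 G) : smear G r (thetaTest 4 v) s U = smearR G r v s (cfgReflect U) := by
  unfold smear smearR
  have hθ : ∀ x : Site 4, thetaTest 4 v (s • siteToE x) = v (s • siteToE (siteReflect x)) := fun x => by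
    rw [thetaTest_apply, timeReflection_smul_siteToE]
  have hd : ∀ x : Site 4, dens G r x U = ∑ q : {q : Fin 4 × Fin 4 // q.1 < q.2},
      plane G r q.1 (siteReflect x - layerShift q.1) (cfgReflect U) := fun x => by
    have h := dens_cfgReflect_eq_sum_plane r x (cfgReflect U)
    rw [cfgReflect_cfgReflect] at h
    rw [h]
    exact Finset.sum_congr rfl fun q _ => by rw [reflSite'_eq]
  simp_rw [hθ, hd, Finset.mul_sum]
  -- per orientation, the summand is `g_q ∘ reflShift ℓ_q` with `g_q x' = v(s (x' + ℓ_q)) · plane_q x' (Θ U)`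
  have key : ∀ q : {q : Fin 4 × Fin 4 // q.1 < q.2},
      (fun x : Site 4 => v (s • siteToE (siteReflect x)) * plane G r q.1 (siteReflect x - layerShift q.1) (cfgReflect U)) =
        (fun x' : Site 4 => v (s • siteToE (x' + layerShift q.1)) * plane G r q.1 x' (cfgReflect U)) ∘
          ⇑(reflShift (layerShift q.1)) := fun q => by
    funext x
    simp only [Function.comp_apply, reflShift_apply, sub_add_cancel]
  have hsum : ∀ q : {q : Fin 4 × Fin 4 // q.1 < q.2},
      Summable fun x : Site 4 => v (s • siteToE (siteReflect x)) * plane G r q.1 (siteReflect x - layerShift q.1) (cfgReflect U) :=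
    fun q => by
      rw [key q, (reflShift (layerShift q.1)).summable_iff]
      exact summable_weight_mul_plane G r (summable_abs_schwartz_lattice_shift v hs (layerShift q.1)) q.1 id _
  rw [Summable.tsum_finsetSum fun q _ => hsum q]
  refine Finset.sum_congr rfl fun q _ => ?_
  rw [key q]
  exact (reflShift (layerShift q.1)).tsum_eq
    fun x' : Site 4 => v (s • siteToE (x' + layerShift q.1)) * plane G r q.1 x' (cfgReflect U)

/-- A positive-time weight only charges plaquettes based at non-negative times (`s > 0`, integer shift `ℓ₀ ≤ 1`). -/
theorem base_nonneg_of_weight_ne_zero {v : EuclideanSpace ℝ (Fin 4) → ℝ}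
    (hv : tsupport v ⊆ {y : EuclideanSpace ℝ (Fin 4) | 0 < y 0}) {s : ℝ} (hs : 0 < s) {ℓ x : Site 4} (hℓ : ℓ 0 ≤ 1)
    (hw : v (s • siteToE (x + ℓ)) ≠ 0) : 0 ≤ x 0 := by
  have hmem := hv (subset_tsupport _ (Function.mem_support.2 hw))
  simp only [Set.mem_setOf_eq, PiLp.smul_apply, siteToE_apply, Pi.add_apply, smul_eq_mul, Int.cast_add] at hmem
  have h2 : (0 : ℤ) < x 0 + ℓ 0 := by
    have h1 := (mul_pos_iff_of_pos_left hs).1 hmem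
    exact_mod_cast h1
  omega

omit [IsTopologicalGroup G] [CompactSpace G] [BorelSpace G] in
/-- **`B′_{v,s}` lives in the positive-time cone** (`tsupport v ⊆ {y₀ > 0}`, `s > 0`). [folklore] -/
theorem smearR_dependsOn {v : EuclideanSpace ℝ (Fin 4) → ℝ} (hv : tsupport v ⊆ {y : EuclideanSpace ℝ (Fin 4) | 0 < y 0})
    {s : ℝ} (hs : 0 < s) : DependsOn (smearR G r v s) (siteHalfEdges (d := 4) 0) := by
  intro U V hUV
  unfold smearR
  refine Finset.sum_congr rfl fun q _ => tsum_congr fun x => ?_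
  by_cases hw : v (s • siteToE (x + layerShift q.1)) = 0
  · simp only [hw, zero_mul]
  · rw [dependsOn_plane r q.1 (base_nonneg_of_weight_ne_zero hv hs (layerShift_apply_zero_le_one q.1) hw) hUV]

/-- **`A_{v,s}` lives in the positive-time cone** (`tsupport v ⊆ {y₀ > 0}`, `s > 0`, `ℓ¹` weights). [folklore] -/
theorem smear_dependsOn {v : EuclideanSpace ℝ (Fin 4) → ℝ} (hv : tsupport v ⊆ {y : EuclideanSpace ℝ (Fin 4) | 0 < y 0})
    {s : ℝ} (hs : 0 < s) (hvs : Summable fun x : Site 4 => |v (s • siteToE x)|) :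
    DependsOn (smear G r v s) (siteHalfEdges (d := 4) 0) := by
  intro U V hUV
  rw [smear_eq_sum_tsum_plane G r hvs, smear_eq_sum_tsum_plane G r hvs]
  refine Finset.sum_congr rfl fun q _ => tsum_congr fun x => ?_
  by_cases hw : v (s • siteToE x) = 0
  · simp only [hw, zero_mul]
  · have hw' : v (s • siteToE (x + 0)) ≠ 0 := by rwa [add_zero]
    rw [dependsOn_plane r q.1 (base_nonneg_of_weight_ne_zero hv hs (ℓ := 0) (by simp) hw') hUV]

/-- **S1 + S2a — the onset floor as a CONE cross floor**: a torus floor `ε ≤ Q2 G r β L s (θv) v` (all odd tori with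
`Λ₅ ≤ s·L`) gives, in EVERY odd-torus limit state `μ`, `ε ≤ Cov_μ(B′_{v,s} ∘ Θ_cfg, A_{v,s})` with BOTH `B′_{v,s}` and `A_{v,s}`
supported in the positive half `siteHalfEdges 0` (so the tree's RP Cauchy–Schwarz / `abs_cov_le_osNorm_mul` and the atomic
pigeonhole `os_pigeonhole` apply to it). [folklore] -/
theorem coneCrossFloor_of_torusFloor {β s ε Λ₅ : ℝ} (hs : 0 < s) (v : SchwartzMap (EuclideanSpace ℝ (Fin 4)) ℝ)
    (hv : tsupport (v : EuclideanSpace ℝ (Fin 4) → ℝ) ⊆ {y : EuclideanSpace ℝ (Fin 4) | 0 < y 0})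
    (hfloor : ∀ L : ℕ, Λ₅ ≤ s * L → ε ≤ Q2 G r β L s (thetaTest 4 v) v)
    {μ : Measure (LGConfig 4 G)} (hμ : μ ∈ oddTorusLimitPoints r β) :
    ε ≤ cov[fun U => smearR G r v s (cfgReflect U), smear G r v s; μ] ∧
      DependsOn (smearR G r v s) (siteHalfEdges (d := 4) 0) ∧ DependsOn (smear G r v s) (siteHalfEdges (d := 4) 0) := by
  refine ⟨?_, smearR_dependsOn G r hv hs, smear_dependsOn G r hv hs (summable_abs_schwartz_lattice v hs)⟩
  have h := crossFloor_of_torusFloor hs (thetaTest 4 v) v hfloor hμ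
  have h1 : (fun U => ∑' x : Site 4, thetaTest 4 v (s • siteToE x) * dens G r x U) =
      fun U => smearR G r v s (cfgReflect U) :=
    funext fun U => smear_thetaTest_eq_smearR_cfgReflect G r v hs U
  rw [h1] at h
  exact h

end SmearCone

end Summit.QuantumFields.YangMills.Theorems.OnsetSkewLawRPOnsetFloorOSPigeonhole

end
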